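import Summits.AnomalousDissipation.AnomalousDissipation.Theses.TameRoughRigidity
import Summits.AnomalousDissipation.AnomalousDissipation.Theorems.GPStatisticalRigidity.Negative.LoadBearing

/-!
# Crux `TameRoughRigidity.TameToRough` (stmt-AnomalousDissipation-18401) — strategist's normal forms

Crux-strategist seat `planner-cstrat-stmt-AnomalousDissipation-18401-b1-0` (2026-08-17), companion file of
`Cruxes/TameToRough/STRATEGY-CENSUS.md`. Nothing here asserts the crux; everything is kernel-checked
STRUCTURE of the crux R = CONDITIONAL ONSAGER CALIBRATION, used by the census:

* `CalibAt f E` — R's conclusion at level `E` (threshold `G₁`, constants `c, δ₀`).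
* `calibAt_iff_noRougheningAt` — **normal form**: `CalibAt f E` holds iff there is NO ROUGHENING SEQUENCE at
  level `E`: admissible `μₙ` (probability, integrable energy `≤ E`, finite mean enstrophy, shell work `≥ 0`) with
  defect constants `Rₙ → 0`, mean enstrophy `Gₙ → ∞` and virtual dissipation `Rₙ √Gₙ → 0`. The tame gap
  hypothesis of R and the threshold clause play no role in this equivalence (the threshold is what forces
  `Gₙ → ∞`); so R reads: Gap → (no roughening sequence at any level).
* `tameToRough_iff` — the crux BY NAME is `Gap f_GP → ∀ E, NoRougheningAt f_GP E`.
* `gapRateAt_iff_calibAt` — the "quantitative gap" `r(E,G) ≥ c/√G` (lens STRENGTHEN, census §2) is a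
  RESTATEMENT of `CalibAt`, not a strengthening.
* `CalibPowAt f θ E`, `calibPowAt_mono` — the exponent family `c ≤ R·G^θ`; `θ = 1/2` is R; larger `θ` is weaker
  (for NS statistics `R√G ≤ νG = ε`, so `θ = 1/2` is the only exponent that yields a dissipation floor).
* Signatures only (census §§1–4): `CalibDiracAt` (single-field special case), `UniformCertificatesAt` (the
  hypothesis of the landed weak duality `stub_weakDuality2`, i.e. the parent line's C2 shape),
  `StrongDualityTame` (the one lemma-with-teeth of the certificate language), `NoHolderDodgerGP` (the typed
  obstruction met by the negation attempt).
-/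

noncomputable section

open MeasureTheory Filter Topology UnitAddTorus
open scoped InnerProductSpace ENNReal NNReal

set_option linter.dupNamespace false

namespace Summit.AnomalousDissipation.AnomalousDissipation.Cruxes.TameToRough.NormalForm

open Literature.Analysis.FunctionSpaces Literature.Analysis.FluidPDE
open Summit.AnomalousDissipation.AnomalousDissipation.Theorems.GPStatisticalRigidity.Negative

/-- Local notation: real vector fields on `T³`. -/
local notation "Vec3" => (UnitAddTorus (Fin 3)) → (EuclideanSpace ℝ (Fin 3))
/-- Local notation: `L²(T³; ℝ³)`. -/
local notation "L2" => (Lp (EuclideanSpace ℝ (Fin 3)) 2 (volume : Measure (UnitAddTorus (Fin 3))))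
/-- Local notation: the energy space `H`. -/
local notation "H3" => (Torus.energySpace (Fin 3))

/-! ## §0 Vocabulary -/

/-- Admissible statistics at level `E` (hypotheses 1–5 of the crux's conclusion block). -/
def Admissible (f : Vec3) (E : ℝ) (μ : Measure H3) : Prop :=
  IsProbabilityMeasure μ ∧ Integrable (fun v : H3 => ‖v‖ ^ 2) μ ∧ Torus.ensembleEnergy μ ≤ E ∧
    Torus.ensembleEnstrophy μ < ⊤ ∧ ShellWorkNonneg f μ

/-- The TAME DEFECT GAP (hypothesis of R; `↔ GPEulerCoercive ∧ TameClosure` by the refuter's W.lean). -/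
def Gap (f : Vec3) : Prop :=
  ∀ E G₁ : ℝ, ∃ r : ℝ, 0 < r ∧ ∀ μ : Measure H3, IsProbabilityMeasure μ →
    Integrable (fun v : H3 => ‖v‖ ^ 2) μ → Torus.ensembleEnergy μ ≤ E →
      Torus.ensembleEnstrophy μ ≤ ENNReal.ofReal G₁ → ¬ DefectLE f μ r

/-- R's conclusion at level `E`: CALIBRATION `c ≤ R √G` above an enstrophy threshold. -/
def CalibAt (f : Vec3) (E : ℝ) : Prop :=
  ∃ G₁ c δ₀ : ℝ, 0 < c ∧ 0 < δ₀ ∧ ∀ μ : Measure H3, Admissible f E μ →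
    ENNReal.ofReal G₁ ≤ Torus.ensembleEnstrophy μ → ∀ R : ℝ, 0 ≤ R → R ≤ δ₀ → DefectLE f μ R →
      c ≤ R * Real.sqrt (Torus.ensembleEnstrophy μ).toReal

/-- A ROUGHENING (violating) SEQUENCE at level `E`: admissible `μₙ` with defect constants `Rₙ → 0`,
mean enstrophy `Gₙ → ∞` and virtual dissipation `Rₙ √Gₙ → 0`. -/
def IsRougheningSeq (f : Vec3) (E : ℝ) (μ : ℕ → Measure H3) (R : ℕ → ℝ) : Prop :=
  (∀ n, Admissible f E (μ n)) ∧ (∀ n, 0 ≤ R n) ∧ (∀ n, DefectLE f (μ n) (R n)) ∧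
    Tendsto (fun n => (Torus.ensembleEnstrophy (μ n)).toReal) atTop atTop ∧
    Tendsto R atTop (𝓝 0) ∧
    Tendsto (fun n => R n * Real.sqrt (Torus.ensembleEnstrophy (μ n)).toReal) atTop (𝓝 0)

/-- No roughening sequence at level `E`. -/
def NoRougheningAt (f : Vec3) (E : ℝ) : Prop :=
  ∀ (μ : ℕ → Measure H3) (R : ℕ → ℝ), ¬ IsRougheningSeq f E μ R

/-! ## §1 The normal form -/

/-- **Normal form of the calibration.** `CalibAt f E ↔ NoRougheningAt f E`. (→): along a roughening
sequence eventually `G ≥ G₁` and `R ≤ δ₀`, so `c ≤ Rₙ√Gₙ → 0`, absurd. (←): if calibration fails, the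
choices `G₁ = n`, `c = δ₀ = 1/(n+1)` produce a roughening sequence. Neither Gap nor anything about `f` is used. -/
theorem calibAt_iff_noRougheningAt (f : Vec3) (E : ℝ) : CalibAt f E ↔ NoRougheningAt f E := by
  constructor
  · rintro ⟨G₁, c, δ₀, hc, hδ₀, hcal⟩ μ R ⟨hadm, hR0, hdef, hG, hR, hRG⟩
    have h1 : ∀ᶠ n in atTop, G₁ ≤ (Torus.ensembleEnstrophy (μ n)).toReal := hG.eventually_ge_atTop G₁
    have h2 : ∀ᶠ n in atTop, R n < δ₀ := hR.eventually (gt_mem_nhds hδ₀)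
    have h3 : ∀ᶠ n in atTop, R n * Real.sqrt (Torus.ensembleEnstrophy (μ n)).toReal < c :=
      hRG.eventually (gt_mem_nhds hc)
    obtain ⟨n, ⟨hn1, hn2⟩, hn3⟩ := ((h1.and h2).and h3).exists
    have hfin : Torus.ensembleEnstrophy (μ n) ≠ ⊤ := (hadm n).2.2.2.1.ne
    have hth : ENNReal.ofReal G₁ ≤ Torus.ensembleEnstrophy (μ n) :=
      (ENNReal.ofReal_le_iff_le_toReal hfin).2 hn1
    have := hcal (μ n) (hadm n) hth (R n) (hR0 n) hn2.le (hdef n)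
    linarith
  · intro h
    rw [CalibAt]
    by_contra hcal
    push Not at hcal
    have h' : ∀ n : ℕ, ∃ (μ : Measure H3) (R : ℝ), Admissible f E μ ∧
        ENNReal.ofReal (n : ℝ) ≤ Torus.ensembleEnstrophy μ ∧ 0 ≤ R ∧ R ≤ 1 / ((n : ℝ) + 1) ∧
        DefectLE f μ R ∧ R * Real.sqrt (Torus.ensembleEnstrophy μ).toReal < 1 / ((n : ℝ) + 1) := by
      intro n
      obtain ⟨μ, hadm, hth, R, hR0, hRδ, hdef, hlt⟩ :=
        hcal (n : ℝ) (1 / ((n : ℝ) + 1)) (1 / ((n : ℝ) + 1)) (by positivity) (by positivity)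
      exact ⟨μ, R, hadm, hth, hR0, hRδ, hdef, hlt⟩
    choose μ R hadm hth hR0 hRδ hdef hlt using h'
    refine h μ R ⟨hadm, hR0, hdef, ?_, ?_, ?_⟩
    · refine tendsto_atTop_mono (fun n => ?_) tendsto_natCast_atTop_atTop
      exact (ENNReal.ofReal_le_iff_le_toReal (hadm n).2.2.2.1.ne).1 (hth n)
    · exact squeeze_zero (fun n => hR0 n) (fun n => hRδ n) tendsto_one_div_add_atTop_nhds_zero_nat
    · exact squeeze_zero (fun n => mul_nonneg (hR0 n) (Real.sqrt_nonneg _)) (fun n => (hlt n).le)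
        tendsto_one_div_add_atTop_nhds_zero_nat

/-- **The crux by name, in normal form.** `TameToRough ↔ (Gap f_GP → ∀ E, NoRougheningAt f_GP E)`:
R says exactly "under the tame gap, f_GP admits no roughening sequence of near-statistics at any energy
level". -/
theorem tameToRough_iff :
    Summit.AnomalousDissipation.AnomalousDissipation.Theses.TameRoughRigidity.TameToRough ↔
      (Gap gpForce → ∀ E : ℝ, NoRougheningAt gpForce E) := by
  constructor
  · intro h hgap E
    rw [← calibAt_iff_noRougheningAt]
    obtain ⟨G₁, c, δ₀, hc, hδ₀, H⟩ := h gpForce rfl hgap E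
    exact ⟨G₁, c, δ₀, hc, hδ₀, fun μ hadm hth R hR0 hRδ hdef =>
      H μ hadm.1 hadm.2.1 hadm.2.2.1 hadm.2.2.2.1 hth hadm.2.2.2.2 R hR0 hRδ hdef⟩
  · intro h f hf hgap E
    subst hf
    have hcal : CalibAt gpForce E := (calibAt_iff_noRougheningAt gpForce E).2 (h hgap E)
    obtain ⟨G₁, c, δ₀, hc, hδ₀, H⟩ := hcal
    exact ⟨G₁, c, δ₀, hc, hδ₀, fun μ hp hi hE hG hth hs R hR0 hRδ hdef =>
      H μ ⟨hp, hi, hE, hG, hs⟩ hth R hR0 hRδ hdef⟩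

/-! ## §2 Lens STRENGTHEN: the quantitative gap is a restatement; the exponent family -/

/-- `DefectLE` is monotone in the constant. -/
theorem defectLE_mono {f : Vec3} {μ : Measure H3} {R R' : ℝ} (h : DefectLE f μ R) (hRR' : R ≤ R') :
    DefectLE f μ R' := fun Φ =>
  ⟨(h Φ).1, (h Φ).2.trans (mul_le_mul_of_nonneg_right hRR' (Real.sqrt_nonneg _))⟩

/-- QUANTITATIVE GAP at rate `G^{-1/2}`: above a threshold no admissible statistics has defect constant
`c/√G` — the natural "strengthening" S⁺ of the qualitative tame gap. -/
def GapRateAt (f : Vec3) (E : ℝ) : Prop :=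
  ∃ G₁ c : ℝ, 0 < c ∧ ∀ μ : Measure H3, Admissible f E μ → ENNReal.ofReal G₁ ≤ Torus.ensembleEnstrophy μ →
    ¬ DefectLE f μ (c / Real.sqrt (Torus.ensembleEnstrophy μ).toReal)

/-- **S⁺ is a restatement.** `GapRateAt f E ↔ CalibAt f E` (monotonicity of `DefectLE` one way; the
threshold `G ≥ max G₁ 1 ⊔ (c/(2δ₀))²` and `c' = c/2` the other way). -/
theorem gapRateAt_iff_calibAt (f : Vec3) (E : ℝ) : GapRateAt f E ↔ CalibAt f E := by
  constructor
  · rintro ⟨G₁, c, hc, h⟩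
    refine ⟨max G₁ 1, c, 1, hc, one_pos, fun μ hadm hth R hR0 _ hdef => ?_⟩
    have hfin : Torus.ensembleEnstrophy μ ≠ ⊤ := hadm.2.2.2.1.ne
    have hth' := (ENNReal.ofReal_le_iff_le_toReal hfin).1 hth
    have hG1 : 1 ≤ (Torus.ensembleEnstrophy μ).toReal := le_trans (le_max_right _ _) hth'
    have hthG₁ : ENNReal.ofReal G₁ ≤ Torus.ensembleEnstrophy μ :=
      (ENNReal.ofReal_le_iff_le_toReal hfin).2 (le_trans (le_max_left _ _) hth')
    have hspos : 0 < Real.sqrt (Torus.ensembleEnstrophy μ).toReal := Real.sqrt_pos.2 (by linarith)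
    by_contra hlt
    push Not at hlt
    have hRlt : R < c / Real.sqrt (Torus.ensembleEnstrophy μ).toReal := by
      rw [lt_div_iff₀ hspos]; exact hlt
    exact h μ hadm hthG₁ (defectLE_mono hdef hRlt.le)
  · rintro ⟨G₁, c, δ₀, hc, hδ₀, h⟩
    refine ⟨max (max G₁ 1) ((c / δ₀) ^ 2), c / 2, by positivity, fun μ hadm hth hdef => ?_⟩
    have hfin : Torus.ensembleEnstrophy μ ≠ ⊤ := hadm.2.2.2.1.ne
    have hth' := (ENNReal.ofReal_le_iff_le_toReal hfin).1 hth
    set G : ℝ := (Torus.ensembleEnstrophy μ).toReal with hG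
    have hG1 : 1 ≤ G := le_trans (le_trans (le_max_right _ _) (le_max_left _ _)) hth'
    have hGc : (c / δ₀) ^ 2 ≤ G := le_trans (le_max_right _ _) hth'
    have hGpos : 0 < G := by linarith
    have hsqrt_pos : 0 < Real.sqrt G := Real.sqrt_pos.2 hGpos
    have hthG₁ : ENNReal.ofReal G₁ ≤ Torus.ensembleEnstrophy μ := by
      refine (ENNReal.ofReal_le_iff_le_toReal hfin).2 ?_
      exact le_trans (le_trans (le_max_left _ _) (le_max_left _ _)) hth'
    -- the candidate defect constant `c/(2√G)` is `≤ δ₀` because `√G ≥ c/δ₀`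
    have hcδ : c / δ₀ ≤ Real.sqrt G := by
      have h0 : 0 ≤ c / δ₀ := by positivity
      calc c / δ₀ = Real.sqrt ((c / δ₀) ^ 2) := (Real.sqrt_sq h0).symm
        _ ≤ Real.sqrt G := Real.sqrt_le_sqrt hGc
    have hRδ : c / 2 / Real.sqrt G ≤ δ₀ := by
      rw [div_le_iff₀ hsqrt_pos]
      have : c ≤ δ₀ * Real.sqrt G := by
        have := mul_le_mul_of_nonneg_left hcδ hδ₀.le
        rwa [mul_div_cancel₀ _ hδ₀.ne'] at this
      linarith
    have hR0 : 0 ≤ c / 2 / Real.sqrt G := by positivity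
    have := h μ hadm hthG₁ (c / 2 / Real.sqrt G) hR0 hRδ hdef
    rw [div_mul_cancel₀ _ hsqrt_pos.ne'] at this
    linarith

/-- THE EXPONENT FAMILY `c ≤ R · G^θ` (`θ = 1/2` is R's conclusion). -/
def CalibPowAt (f : Vec3) (θ E : ℝ) : Prop :=
  ∃ G₁ c δ₀ : ℝ, 0 < c ∧ 0 < δ₀ ∧ ∀ μ : Measure H3, Admissible f E μ →
    ENNReal.ofReal G₁ ≤ Torus.ensembleEnstrophy μ → ∀ R : ℝ, 0 ≤ R → R ≤ δ₀ → DefectLE f μ R →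
      c ≤ R * (Torus.ensembleEnstrophy μ).toReal ^ θ

/-- `θ = 1/2` is the crux's conclusion. -/
theorem calibPowAt_half_iff (f : Vec3) (E : ℝ) : CalibPowAt f (1 / 2) E ↔ CalibAt f E := by
  simp only [CalibPowAt, CalibAt, Real.sqrt_eq_rpow]

/-- **Larger exponents are weaker** (threshold raised to `≥ 1`): `θ ≤ θ' → CalibPowAt f θ E → CalibPowAt f θ' E`.
So any proof technique that only yields `R·G^θ ≥ c` with `θ > 1/2` (e.g. the K41 heuristic `R^{4/3}G ≳ 1`,
`θ = 3/4`) proves a strictly weaker statement that does NOT feed the route's `closes` (it would give a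
sub-anomalous floor `ε ≳ ν^{(2θ-1)/(2θ+1)}`, not `ε ≥ c`). -/
theorem calibPowAt_mono (f : Vec3) {θ θ' : ℝ} (E : ℝ) (hθ : θ ≤ θ') (h : CalibPowAt f θ E) :
    CalibPowAt f θ' E := by
  obtain ⟨G₁, c, δ₀, hc, hδ₀, H⟩ := h
  refine ⟨max G₁ 1, c, δ₀, hc, hδ₀, fun μ hadm hth R hR0 hRδ hdef => ?_⟩
  have hfin : Torus.ensembleEnstrophy μ ≠ ⊤ := hadm.2.2.2.1.ne
  have hth' := (ENNReal.ofReal_le_iff_le_toReal hfin).1 hth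
  have hG1 : 1 ≤ (Torus.ensembleEnstrophy μ).toReal := le_trans (le_max_right _ _) hth'
  have hthG₁ : ENNReal.ofReal G₁ ≤ Torus.ensembleEnstrophy μ :=
    (ENNReal.ofReal_le_iff_le_toReal hfin).2 (le_trans (le_max_left _ _) hth')
  refine (H μ hadm hthG₁ R hR0 hRδ hdef).trans ?_
  exact mul_le_mul_of_nonneg_left (Real.rpow_le_rpow_of_exponent_le hG1 hθ) hR0

/-! ## §3 Signatures for the census (no assertions) -/

/-- LENS DECOMPOSITION, candidate piece (a): the DIRAC (single-field) special case of the calibration under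
the tame gap — conditional Lamb rigidity of `f_GP` at level `E` (cf. `VirtualDissipation.LambRigidGP`,
`Negative/DiracShadow.lean`). Strictly weaker than `CalibAt` (special case), still open; the complementary
piece "Dirac ⇒ measures" has no plan (near-stationary measures need not have near-stationary atoms). -/
def CalibDiracAt (f : Vec3) (E : ℝ) : Prop :=
  ∃ G₁ c δ₀ : ℝ, 0 < c ∧ 0 < δ₀ ∧ ∀ u : H3, Admissible f E (Measure.dirac u) →
    ENNReal.ofReal G₁ ≤ Torus.ensembleEnstrophy (Measure.dirac u) → ∀ R : ℝ, 0 ≤ R → R ≤ δ₀ →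
      DefectLE f (Measure.dirac u) R → c ≤ R * Real.sqrt (Torus.ensembleEnstrophy (Measure.dirac u)).toReal

/-- `CalibAt → CalibDiracAt` (special case). -/
theorem calibDiracAt_of_calibAt {f : Vec3} {E : ℝ} (h : CalibAt f E) : CalibDiracAt f E := by
  obtain ⟨G₁, c, δ₀, hc, hδ₀, H⟩ := h
  exact ⟨G₁, c, δ₀, hc, hδ₀, fun u hadm hth R hR0 hRδ hdef => H _ hadm hth R hR0 hRδ hdef⟩

/-- LENS DECOMPOSITION, candidate piece (b): UNIFORM CERTIFICATE FAMILY at level `E` — verbatim the hypothesis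
`hfam` of the landed weak duality `EnsembleRigidity.GPStatisticalRigidity.stub_weakDuality2` (p130387), i.e.
the parent line's open stub C2 without its energy side-condition. By W2, `UniformCertificatesAt f E → CalibAt f E`
(with `G₁ = 0`); the converse is strong duality with Λ-UNIFORM constants — the whole crux in dual language. -/
def UniformCertificatesAt (f : Vec3) (E : ℝ) : Prop :=
  ∃ γ C : ℝ, 0 < γ ∧ 0 < C ∧ ∀ Λ : ℝ, 0 < Λ →
    ∃ (Ψ : Torus.CylindricalTest (Fin 3)) (a b : ℝ), 0 ≤ b ∧ γ ≤ a - b * E ∧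
      (∀ v : H3, Torus.gradNormSq (Ψ.grad v) ≤
        C ^ 2 * (1 + (Torus.eGradNormSq ((v : L2) : Vec3)).toReal)) ∧
      (∀ v : H3, Torus.eGradNormSq ((v : L2) : Vec3) ≠ ⊤ →
        a - b * ‖v‖ ^ 2 - Λ⁻¹ * (1 + (Torus.eGradNormSq ((v : L2) : Vec3)).toReal) ≤
          Torus.nsGeneratorPairing 0 f v (Ψ.grad v))

/-- The one lemma of the certificate language WITH TEETH (census §3): STRONG DUALITY ON THE TAME CLASS —
the tame gap at `(E, G₀)` with constant `r` yields a cylindrical Lyapunov certificate at roughness scale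
`Λ` with SOME margin and cost depending on `(E, G₀, r)` (Farkas/Sion minimax on the weakly compact convex
set of tame probability measures; closure issues = why it might fail). Its output has Λ-DEPENDENT constants;
upgrading them to Λ-uniform ones (`UniformCertificatesAt`) is the crux again. -/
def StrongDualityTame (f : Vec3) : Prop :=
  ∀ E G₀ r : ℝ, 0 < r → 0 < G₀ →
    (∀ μ : Measure H3, IsProbabilityMeasure μ → Integrable (fun v : H3 => ‖v‖ ^ 2) μ →
      Torus.ensembleEnergy μ ≤ E → Torus.ensembleEnstrophy μ ≤ ENNReal.ofReal G₀ → ¬ DefectLE f μ r) →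
    ∃ (Ψ : Torus.CylindricalTest (Fin 3)) (a b lam C : ℝ), 0 ≤ b ∧ 0 ≤ lam ∧ 0 < C ∧
      0 < a - b * E - lam * G₀ ∧
      (∀ v : H3, Torus.gradNormSq (Ψ.grad v) ≤ C ^ 2 * (1 + (Torus.eGradNormSq ((v : L2) : Vec3)).toReal)) ∧
      (∀ v : H3, Torus.eGradNormSq ((v : L2) : Vec3) ≠ ⊤ →
        a - b * ‖v‖ ^ 2 - lam * (Torus.eGradNormSq ((v : L2) : Vec3)).toReal -
            r * C * Real.sqrt (1 + (Torus.eGradNormSq ((v : L2) : Vec3)).toReal) ≤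
          Torus.nsGeneratorPairing 0 f v (Ψ.grad v))

/-- LENS NEGATION, the typed obstruction (census §4): a roughening sequence would follow from ONE bounded-energy
stationary weak Euler solution of `f_GP` of Hölder class `C^σ`, `σ > 1/3` (mollify at scale `ℓ`: defect
`≍ ℓ^{2σ}`, enstrophy `≍ ℓ^{2σ-2}`, virtual dissipation `≍ ℓ^{3σ-1} → 0`). Its absence — stated here for
`H`-valued steady weak solutions with a uniform Hölder modulus — is NECESSARY for R, not sufficient, and is the
adversary class of stationary convex integration (barrier `BuckmasterVicol2019_thm13`), beyond every scheme in
print at a prescribed smooth force. -/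
def NoHolderDodgerGP (σ : ℝ) : Prop :=
  ∀ u : H3, Torus.IsSteadyWeakSolution 0 gpForce u →
    ¬ (∃ A : ℝ, ∀ x y : UnitAddTorus (Fin 3),
        ‖((u : L2) : Vec3) x - ((u : L2) : Vec3) y‖ ≤ A * dist x y ^ σ)

end Summit.AnomalousDissipation.AnomalousDissipation.Cruxes.TameToRough.NormalForm

end
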